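/-
Copyright: the b2b-balaban T⁴-continuum CRUX team, row NE7b leaf lineage `t4-ne7b-formalise-leaf-05` (gen 153). Project licence.
-/
import Literature.MathematicalPhysics.QuantumFieldTheory.Balaban1983to89.B6Lemma24Assembly

/-!
# TWO OF THE (h2) SKELETON's LETTERS INHABITED ON A COMMON INDEX TYPE: the FLAT floor of `…AdmissibleFloorIMS.admissible_floor` from [B6] Lemma 2.4
# (PROVED) for fields indexed by ANY finite `m` embedded in the unit bonds of `Z^d` (zero-extension along an injection — the shape the per-cube letter
# `hflat : ∀ s Y, good⁰_s Y → c·(Y ⬝ᵥ Y) ≤ F⁰_s Y` needs when all cubes share one index type), and the ADMISSIBILITY TRANSPORT (adm) for cutoffs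
# (support and axial gauge pass to `h_s·x` pointwise — the block-AVERAGE constraint is NOT needed on the localised pieces, because `F⁰_s`, `F′_s` are the
# FULL forms with the average term; row NE7b, node U5c; residual (R2′) family (2), letter (ℓ1); kernel lemmas)

Cell `pub-balaban`, sub-cell `t4`, spine estimate NE7b (`T4WeightBudget.RelWeightBound`; the cell's OWN estimate — NOT PRINTED in [Bałaban 1983–89],
NOT PROVED).  Crux-route work under `Spine/NE7b/`; NOTHING of Bałaban's is asserted; no `def`; zero `sorry`; no `T4Continuum/Support` leaf (FREEZE (0)).
Import (hub olean present): `Literature.….Balaban1983to89.B6Lemma24Assembly` (pv09∕b06; `lemma24_kappa0` — [B6] CMP **96** (1984) Lemma 2.4 (2.128) p. 245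
with the repaired layer constant `κ₀`, PROVED, axiom-trio).

WHY.  `…AdmissibleFloorIMS` (this lineage, p378268) proves the (h2) slot of `B9SectEKernel.gamma0_assembly` from five per-cube letters on ONE fibre index
type `m′` shared by all cubes; its §7 `flat_floor_lemma24` inhabits the flat letter for ONE region in the SUBTYPE currency `↥(lamBonds L Λ′) → ℝ`.  A consumer
whose cubes `s` carry regions `Λ′_s` inside one finite bond set `m` (the bonds of `Λ_k`) needs the flat floor for `m`-indexed fields vanishing off
`lamBonds L Λ′_s` — THIS FILE: zero-extension along an injection `e : m ↪ bonds(Z^d)`.  It also records why the chair's reading ι-X-AFI-1 (journal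
l.57677: «(cov)∕(adm) are asked for the LOCALISED field `h_s·x`; in print the partition must respect the block-averaging constraint or `F′_s` absorb the
defect») is absorbed by the FULL-form design: (adm) asks only SUPPORT and AXIAL GAUGE of `h_s·x`, both pointwise consequences of `x`'s (§2), while the
average constraint `Q₁(V)x = 0` enters once, globally, through `⟨x, K_F x⟩ ≤ F x` (`hFK`) — never on the pieces.

WHAT IS PROVED ([folklore]):
* §1 **`flat_floor_lemma24_extend`** — `d ≥ 2`, `L ≥ 1`, `Λ′ ⊂ LZ^d`, `e : m → (Z^d × Fin d)` injective, `Y : m → ℝ` vanishing at every `i` with `e i ∉ lamBonds L Λ′`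
  and at every `i` with `e i` a tree-gauge bond (2.121) of a block of `Λ′` ⊢ `κ₀(d,L)∕(12d²)·L^{−(d+1)}·(Y ⬝ᵥ Y) ≤ L^{d−2}·q1Of(Ỹ) + d1Sq(Ỹ)`,
  `Ỹ := Function.extend e Y 0` (zero-extension) — `lemma24_kappa0` BY NAME; `normSq(Ỹ) = Y ⬝ᵥ Y` by `sum_subset` twice + `sum_image`.
* §2 (adm) FOR CUTOFFS: `cutoff_vanishes_of_right` ∕ `_of_left` ((`h·x`) vanishes where `x` or `h` does), **`adm_of_cutoff`** (support in the cube's region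
  from `h_s`, axial gauge from `x`: the `good x → good⁰_s (h_s·x)` letter of `admissible_floor` at `u_s = id`, predicates spelled as vanishing sets).
* §3 toy: (adm) on `Fin 2` — cutoff supported on `{0}`, field axial on `{1}` (`example` for `adm_of_cutoff`; no lattice toy for §1 — its data are B6's carrier objects).

NOT HERE (honest): the gauged letters `u_s ≠ id`, (cov), (iso), (pert) and `ε_IMS` BY VALUE ((π4)∕R-V, (π8)); the identification of `q1Of` with B5 (1.8)'s `Q₁`
(B6Lemma24Carrier scope (i)); colour components (`…AdmissibleFloorIMS.floor_of_components` composes with §1 by name).  BY-NAME EFFECT ON THE WALL: NONE.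
NE7b NOT PRINTED ∕ NOT PROVED; spine PROVED 0∕9; rung (B)+1 on ONE finite T⁴ — NOT infinite volume, NOT the mass gap, NOT Clay.
HONEST DEPENDENCY: continuum YM on T⁴ ⇐ BetaPertH ∧ nine spine estimates (0/9 proved); BetaPertH ⇐ (D1) ∧ (D4) ∧ CAP+tail; G-an2-4 gates asym, D1 and NE2/3/4.
-/

set_option autoImplicit false

noncomputable section

open Matrix Finset
open Literature.MathematicalPhysics.QuantumFieldTheory.Balaban1983to89.B6LayerPoincare (kappa0)
open Literature.MathematicalPhysics.QuantumFieldTheory.Balaban1983to89.B6BondElimination (treeBonds)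
open Literature.MathematicalPhysics.QuantumFieldTheory.Balaban1983to89.B6Lemma24Carrier (lamBonds normSq q1Of d1Sq)
open Literature.MathematicalPhysics.QuantumFieldTheory.Balaban1983to89.B6Lemma24Assembly (lemma24_kappa0)

namespace Summit.QuantumFields.BalabanUV.T4Continuum.NE7b.AdmissibleFloorLetters

variable {d L : ℕ} {m : Type*}

/-! ## §1 The flat floor for `m`-indexed fields along an injection into the unit bonds of `Z^d` -/

section Flat

/-- The zero-extension reads `Y` on the image: `Ỹ (e i) = Y i`. [folklore] -/
theorem extend_apply_of_injective {e : m → (Fin d → ℤ) × Fin d} (he : Function.Injective e) (Y : m → ℝ) (i : m) :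
    Function.extend e Y 0 (e i) = Y i :=
  he.extend_apply Y 0 i

/-- … and vanishes off the image. [folklore] -/
theorem extend_apply_of_not_mem_range {e : m → (Fin d → ℤ) × Fin d} (Y : m → ℝ) {b : (Fin d → ℤ) × Fin d}
    (hb : ¬∃ i, e i = b) : Function.extend e Y 0 b = 0 := by
  rw [Function.extend_apply' Y (0 : (Fin d → ℤ) × Fin d → ℝ) b hb]; rfl

/-- **`‖Ỹ‖²_Λ = Y ⬝ᵥ Y`**: if `Y` vanishes wherever `e i ∉ lamBonds L Λ′`, the B6 norm of the zero-extension over the bonds of `Λ` is `Y ⬝ᵥ Y`. [folklore] -/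
theorem normSq_extend_eq [Fintype m] {Λ' : Finset (Fin d → ℤ)} {e : m → (Fin d → ℤ) × Fin d} (he : Function.Injective e)
    (Y : m → ℝ) (hY0 : ∀ i, e i ∉ lamBonds L Λ' → Y i = 0) :
    normSq L Λ' (Function.extend e Y 0) = Y ⬝ᵥ Y := by
  classical
  set B := Function.extend e Y 0 with hB
  -- both sums equal the sum over `lamBonds ∪ image e`
  have h1 : ∑ b ∈ lamBonds L Λ', B b ^ 2 = ∑ b ∈ lamBonds L Λ' ∪ Finset.univ.image e, B b ^ 2 := by
    refine Finset.sum_subset Finset.subset_union_left fun b _ hb => ?_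
    by_cases hbe : ∃ i, e i = b
    · obtain ⟨i, rfl⟩ := hbe
      rw [hB, extend_apply_of_injective he, hY0 i hb, zero_pow two_ne_zero]
    · rw [hB, extend_apply_of_not_mem_range Y hbe, zero_pow two_ne_zero]
  have h2 : ∑ b ∈ Finset.univ.image e, B b ^ 2 = ∑ b ∈ lamBonds L Λ' ∪ Finset.univ.image e, B b ^ 2 := by
    refine Finset.sum_subset Finset.subset_union_right fun b _ hb => ?_
    have hbe : ¬∃ i, e i = b := fun ⟨i, hi⟩ => hb (Finset.mem_image.2 ⟨i, Finset.mem_univ _, hi⟩)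
    rw [hB, extend_apply_of_not_mem_range Y hbe, zero_pow two_ne_zero]
  have h3 : ∑ b ∈ Finset.univ.image e, B b ^ 2 = ∑ i, B (e i) ^ 2 :=
    Finset.sum_image fun i _ j _ hij => he hij
  rw [normSq, h1, ← h2, h3]
  simp only [hB, extend_apply_of_injective he, dotProduct, pow_two]

/-- **THE FLAT FLOOR ALONG AN EMBEDDING** ([B6] Lemma 2.4, `lemma24_kappa0` BY NAME): `d ≥ 2`, `L ≥ 1`, `Λ′ ⊂ LZ^d`, `e` injective, `Y : m → ℝ` vanishing at
every index whose bond lies outside `lamBonds L Λ′` and at every index whose bond is a tree-gauge bond (2.121) of a block `B(y)`, `y ∈ Λ′` ⊢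
`κ₀(d,L)∕(12d²)·L^{−(d+1)}·(Y ⬝ᵥ Y) ≤ L^{d−2}·q1Of L Λ′ Ỹ + d1Sq L Λ′ Ỹ`, `Ỹ = Function.extend e Y 0` — the `hflat` letter of `…AdmissibleFloorIMS.admissible_floor`
for the cube with region `Λ′`, on the COMMON index type `m`. [folklore] -/
theorem flat_floor_lemma24_extend [Fintype m] (hd : 2 ≤ d) (hL : 1 ≤ L) {Λ' : Finset (Fin d → ℤ)}
    (hΛ : ∀ y ∈ Λ', ∀ i, (L : ℤ) ∣ y i) {e : m → (Fin d → ℤ) × Fin d} (he : Function.Injective e) (Y : m → ℝ)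
    (hY0 : ∀ i, e i ∉ lamBonds L Λ' → Y i = 0) (hT : ∀ y ∈ Λ', ∀ i, e i ∈ treeBonds L y → Y i = 0) :
    kappa0 d L / (12 * (d : ℝ) ^ 2) * (L : ℝ) ^ (-((d : ℝ) + 1)) * (Y ⬝ᵥ Y) ≤
      (L : ℝ) ^ ((d : ℝ) - 2) * q1Of L Λ' (Function.extend e Y 0) + d1Sq L Λ' (Function.extend e Y 0) := by
  have hB0 : ∀ b, b ∉ lamBonds L Λ' → Function.extend e Y 0 b = 0 := by
    intro b hb
    by_cases hbe : ∃ i, e i = b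
    · obtain ⟨i, rfl⟩ := hbe
      rw [extend_apply_of_injective he]; exact hY0 i hb
    · exact extend_apply_of_not_mem_range Y hbe
  have hTt : ∀ y ∈ Λ', ∀ b ∈ treeBonds L y, Function.extend e Y 0 b = 0 := by
    intro y hy b hb
    by_cases hbe : ∃ i, e i = b
    · obtain ⟨i, rfl⟩ := hbe
      rw [extend_apply_of_injective he]; exact hT y hy i hb
    · exact extend_apply_of_not_mem_range Y hbe
  have h := lemma24_kappa0 hd hL hΛ (Function.extend e Y 0) hB0 hTt
  rwa [normSq_extend_eq he Y hY0] at h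

end Flat

/-! ## §2 (adm) for cutoffs: support and axial gauge pass to `h_s·x` pointwise -/

section Adm

/-- `(h·x) i = 0` where `x i = 0` (axial gauge is inherited by every localised piece). [folklore] -/
theorem cutoff_vanishes_of_right (h x : m → ℝ) {i : m} (hx : x i = 0) : (h * x) i = 0 := by
  rw [Pi.mul_apply, hx, mul_zero]

/-- `(h·x) i = 0` where `h i = 0` (the piece is supported in the cutoff's region). [folklore] -/
theorem cutoff_vanishes_of_left (h x : m → ℝ) {i : m} (hh : h i = 0) : (h * x) i = 0 := by
  rw [Pi.mul_apply, hh, zero_mul]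

/-- **(adm) FOR A CUTOFF, `u_s = id`**: if `h_s` vanishes off the region `R_s` and `x` vanishes on the axial set `T`, then `h_s·x` vanishes off `R_s` and on
`T` — the letter `good x → good⁰_s (h_s·x)` of `…AdmissibleFloorIMS.admissible_floor` with `good⁰_s Y := (∀ i ∉ R_s, Y i = 0) ∧ (∀ i ∈ T, Y i = 0)` and
`good x` containing `∀ i ∈ T, x i = 0`.  NO averaging constraint on the piece is asked: the average term lives inside the full forms `F⁰_s`, `F′_s`.
[folklore] -/
theorem adm_of_cutoff (h x : m → ℝ) (R T : Set m) (hR : ∀ i ∉ R, h i = 0) (hxT : ∀ i ∈ T, x i = 0) :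
    (∀ i ∉ R, (h * x) i = 0) ∧ (∀ i ∈ T, (h * x) i = 0) :=
  ⟨fun i hi => cutoff_vanishes_of_left h x (hR i hi), fun i hi => cutoff_vanishes_of_right h x (hxT i hi)⟩

end Adm

/-! ## §3 Toy -/

section Toy

/- (adm) on `Fin 2`: cutoff supported on `{0}`, field axial on `{1}`. -/
example : (∀ i ∉ ({0} : Set (Fin 2)), (![1, 0] * ![3, 0] : Fin 2 → ℝ) i = 0) ∧
    (∀ i ∈ ({1} : Set (Fin 2)), (![1, 0] * ![3, 0] : Fin 2 → ℝ) i = 0) :=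
  adm_of_cutoff (m := Fin 2) ![1, 0] ![3, 0] {0} {1}
    (fun i hi => by fin_cases i <;> simp_all)
    (fun i hi => by fin_cases i <;> simp_all)

end Toy

end Summit.QuantumFields.BalabanUV.T4Continuum.NE7b.AdmissibleFloorLetters

end
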